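import Literature.NumberTheory.EllipticCurves.CongruentNumberEvenMonskySelmerLocal
import HarnessLib

/-!
# Complete `2`-descent on `E_n : y² = x³ − n²x`, `n = p₁⋯p_k` ODD: the local conditions on Selmer classes
# in the currency of Monsky's matrix (additive Legendre symbols)

Topic `NumberTheory/EllipticCurves`; namespace
`Literature.NumberTheory.EllipticCurves.CongruentNumberOddMonskySelmer`. A pure proof file (theorems only);
part 1 of 2 for ODD `n` — the companion of `CongruentNumberEvenMonskySelmerLocal.lean` (even `n = 2p₁⋯p_k`).
Part 2 (`CongruentNumberOddMonskySelmerBound.lean`) assembles these relations into Monsky's ODD matrix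
`M = ( A + D₂  D₂ ; D₂  A + D₋₂ )` and proves `#Sel⁽²⁾(E_n/ℚ) ≤ 2^{2+s(n)}` for every `k` — the upper-bound
half of the appendix of P. Monsky to Heath-Brown, Invent. Math. 118 (1994), ODD case (typescript p. 38 L17 –
p. 39 L33; the tree's named fact `HeathBrown1994.monsky_card_selmerGroup_two_odd`).

For `E_n : y² = (x + n)·x·(x − n)`, `n = p₁⋯p_k` (distinct odd primes; `e₁ = −n < e₂ = 0 < e₃ = n`), a class
`c ∈ Sel⁽²⁾(E_n/ℚ)` has components `[a]` (`T₁ = (−n, 0)`, "`x + n`") and `[b]` (`T₂ = (0, 0)`, "`x`") in `ℚˣ/ℚˣ²`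
(representatives `a, b ∈ ℚˣ`, written as in the even files). Through the tree's descent–Selmer bridge this file
proves, uniformly in `k`:

* §1 small dictionary additions: `[(−2/ℓ)=−1] = [(−1/ℓ)=−1] + [(2/ℓ)=−1]` (`addLegendreSym_neg_two`),
  `qrBit pᵢ n = A_ii = Σ_{j≠i} [(pⱼ/pᵢ)=−1]` (`qrBit_n_odd`);
* §2 the LOCAL CONDITIONS on a Selmer class of `E_n`, `n` odd: even valuation off `{2, p₁, …, p_k}` for both
  components AND even `2`-adic valuation of `b` (`even_padicValRat_two_of_mem`: at `2` the roots `0, ∓n` of the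
  `T₂`-model are `2`-adic units apart, so `2` is a GOOD place for the component `x − 0`; Silverman X.1.4 at
  `v = 2` through `even_padicValRat_of_mem_selmerGroup`), `a > 0`, and the two `I₀*` relations at each `pᵢ` with
  the constants `e₂ − e₁ = n`, `(e₁ − e₂)(e₁ − e₃) = 2n²`, `(e₂ − e₁)(e₂ − e₃) = −n²`, `e₁ − e₂ = −n` evaluated
  (`qrBit_rel_of_mem`): `qr_{pᵢ}(a) = αᵢ·A_ii + βᵢ·[2]ᵢ`, `qr_{pᵢ}(b) = αᵢ·[−1]ᵢ + βᵢ·([−1]ᵢ + A_ii)`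
  (`αᵢ = v_{pᵢ}(a)`, `βᵢ = v_{pᵢ}(b) mod 2`).
The square-free kernel expansion `qrBit_expand` of the even file applies verbatim (it only concerns the primes).
These are the printed local solubility conditions of the appendix (p. 38 L24–L31: the four cases
`p ∤ ab`, `p ∣ a`, `p ∣ b`, `p ∣ (a, b)` with the symbols `(2D/a / p)`, `(2b/p)`, `(2a/p)`, `(−2D/b / p)`, …) for the
tree's Selmer classes. Everything is proved; no named facts; nothing about any class is booked.
Cell `bsd-monsky` (run/shared/lean/pub/bsd-monsky/, prover-B; the odd classes `n ≡ 1, 3, 5, 7 (mod 8)` of the record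
`P2/CongruentNumberOddAokiMonsky*`).

## References

* [HeathBrown1994SelmerCongruentII] D. R. Heath-Brown, *The size of Selmer groups for the congruent number
  problem, II*, with an appendix by P. Monsky, Invent. Math. 118 (1994) 331–370: Appendix, typescript p. 38
  L17–L37 (equations (30), the local conditions), p. 39 L1–L33 (`A`, `D_j`, `M`, `s(D) = 2n − rank M`).
* [SilvermanAEC2009] J. H. Silverman, *The Arithmetic of Elliptic Curves*, 2nd ed., GTM 106, Springer 2009,
  Prop. X.1.4, Prop. X.4.9.
-/

noncomputable section

open scoped Classical

open WeierstrassCurve WeierstrassCurve.Affine WeierstrassCurve.Affine.Point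
open Literature.NumberTheory.GaloisRepresentations
open Literature.NumberTheory.EllipticCurves.KramerTwoDescent
open Literature.NumberTheory.EllipticCurves.TwoDescentLocal
open IsDedekindDomain NumberField Rat.HeightOneSpectrum
open Literature.NumberTheory.EllipticCurves.HeathBrown1994
open Matrix

namespace Literature.NumberTheory.EllipticCurves

namespace CongruentNumberOddMonskySelmer

open CongruentNumberEvenMonskySelmer

/-! ## §1 Dictionary additions -/

/-- `[(−2/ℓ) = −1] = [(−1/ℓ) = −1] + [(2/ℓ) = −1]` for an odd prime `ℓ` (multiplicativity of the Legendre symbol, additively).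
[cite: HeathBrown1994SelmerCongruentII, Appendix (Monsky), typescript p. 39 L10–L13] -/
theorem addLegendreSym_neg_two {ℓ : ℕ} (hℓ : ℓ.Prime) (hℓ2 : ℓ ≠ 2) :
    addLegendreSym (-2) ℓ = addLegendreSym (-1) ℓ + addLegendreSym 2 ℓ := by
  haveI : Fact ℓ.Prime := ⟨hℓ⟩
  have h2 : ¬ (ℓ : ℤ) ∣ 2 := fun hd =>
    hℓ2 ((Nat.prime_dvd_prime_iff_eq hℓ Nat.prime_two).mp (by exact_mod_cast hd))
  have hm1 : ¬ (ℓ : ℤ) ∣ (-1 : ℤ) := fun hd => by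
    have := Int.eq_one_of_dvd_one (Int.natCast_nonneg ℓ) ((Int.dvd_neg).mp hd)
    exact hℓ.ne_one (by exact_mod_cast this)
  have hm2 : ¬ (ℓ : ℤ) ∣ (-2 : ℤ) := fun hd => h2 ((Int.dvd_neg).mp hd)
  rw [← qrBit_intCast_eq_addLegendreSym hm2, ← qrBit_intCast_eq_addLegendreSym hm1,
    ← qrBit_intCast_eq_addLegendreSym h2, show ((-2 : ℤ) : ℚ) = ((-1 : ℤ) : ℚ) * ((2 : ℤ) : ℚ) by norm_num,
    qrBit_mul ℓ (by norm_num) (by norm_num)]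

/-! ## §2 The primes `p₁, …, p_k` and `n = p₁⋯p_k` (odd) -/

variable {k : ℕ} {p : Fin k → ℕ}

/-- `∏ pᵢ ≠ 0` (as a rational) for primes `pᵢ`. [folklore] -/
private theorem prod_cast_ne_zero (hp : ∀ i, (p i).Prime) : (∏ i, (p i : ℚ)) ≠ 0 :=
  Finset.prod_ne_zero_iff.mpr fun i _ => Nat.cast_ne_zero.mpr (hp i).ne_zero

/-- `∏ pᵢ ≠ 0`. [folklore] -/
private theorem prod_ne_zero (hp : ∀ i, (p i).Prime) : ∏ i, p i ≠ 0 :=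
  Finset.prod_ne_zero_iff.mpr fun i _ => (hp i).ne_zero

/-- The valuation of `∏ pⱼ` at `pᵢ` is `1`. [folklore] -/
private theorem padicValRat_prod_self (hp : ∀ i, (p i).Prime) (hinj : Function.Injective p) (i : Fin k) :
    haveI : Fact (p i).Prime := ⟨hp i⟩
    padicValRat (p i) (∏ j, (p j : ℚ)) = 1 := by
  haveI : Fact (p i).Prime := ⟨hp i⟩
  have himg : (∏ j, (p j : ℚ)) = ∏ q ∈ Finset.univ.image p, (q : ℚ) := by
    rw [Finset.prod_image fun x _ y _ h => hinj h]
  rw [himg, padicValRat_prod_primes (fun q hq => by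
    obtain ⟨j, -, rfl⟩ := Finset.mem_image.mp hq; exact hp j), if_pos (Finset.mem_image_of_mem p (Finset.mem_univ i))]

/-- The valuation of `∏ pⱼ` at a prime `r` different from every `pⱼ` is `0` (this includes `r = 2`). [folklore] -/
private theorem padicValRat_prod_other (hp : ∀ i, (p i).Prime) (hinj : Function.Injective p) {r : ℕ}
    (hr : r.Prime) (hrp : ∀ j, p j ≠ r) :
    haveI : Fact r.Prime := ⟨hr⟩
    padicValRat r (∏ j, (p j : ℚ)) = 0 := by
  haveI : Fact r.Prime := ⟨hr⟩
  have himg : (∏ j, (p j : ℚ)) = ∏ q ∈ Finset.univ.image p, (q : ℚ) := by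
    rw [Finset.prod_image fun x _ y _ h => hinj h]
  rw [himg, padicValRat_prod_primes (fun q hq => by
    obtain ⟨j, -, rfl⟩ := Finset.mem_image.mp hq; exact hp j), if_neg (fun h => by
      obtain ⟨j, -, hj⟩ := Finset.mem_image.mp h; exact hrp j hj)]

/-- The valuation of `2^e ∏ pⱼ` at `pᵢ` is `1` (`pᵢ` odd). [folklore] -/
private theorem padicValRat_two_pow_mul_prod_self (hp : ∀ i, (p i).Prime) (hp2 : ∀ i, p i ≠ 2)
    (hinj : Function.Injective p) (i : Fin k) (e : ℕ) :
    haveI : Fact (p i).Prime := ⟨hp i⟩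
    padicValRat (p i) ((2 : ℚ) ^ e * ∏ j, (p j : ℚ)) = 1 := by
  haveI : Fact (p i).Prime := ⟨hp i⟩
  haveI : Fact (Nat.Prime 2) := ⟨Nat.prime_two⟩
  rw [padicValRat.mul (pow_ne_zero _ two_ne_zero) (prod_cast_ne_zero hp), padicValRat.pow,
    show (2 : ℚ) = ((2 : ℕ) : ℚ) from rfl, padicValRat.of_nat, padicValNat_primes (hp2 i),
    padicValRat_prod_self hp hinj i]
  simp

/-- The valuation of `2^e ∏ pⱼ` at an odd prime `r` different from every `pⱼ` is `0`. [folklore] -/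
private theorem padicValRat_two_pow_mul_prod_other (hp : ∀ i, (p i).Prime) (hinj : Function.Injective p)
    {r : ℕ} (hr : r.Prime) (hr2 : r ≠ 2) (hrp : ∀ j, p j ≠ r) (e : ℕ) :
    haveI : Fact r.Prime := ⟨hr⟩
    padicValRat r ((2 : ℚ) ^ e * ∏ j, (p j : ℚ)) = 0 := by
  haveI : Fact r.Prime := ⟨hr⟩
  haveI : Fact (Nat.Prime 2) := ⟨Nat.prime_two⟩
  rw [padicValRat.mul (pow_ne_zero _ two_ne_zero) (prod_cast_ne_zero hp), padicValRat.pow,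
    show (2 : ℚ) = ((2 : ℕ) : ℚ) from rfl, padicValRat.of_nat, padicValNat_primes hr2,
    padicValRat_prod_other hp hinj hr hrp]
  simp

/-- `qrBit pᵢ n = A_ii = Σ_{j ≠ i} [(pⱼ/pᵢ) = −1]` for `n = p₁⋯p_k` (`n = pᵢ · ∏_{j≠i} pⱼ`).
[cite: HeathBrown1994SelmerCongruentII, Appendix (Monsky), typescript p. 39 L13–L26] -/
theorem qrBit_n_odd (hp : ∀ i, (p i).Prime) (hinj : Function.Injective p) (i : Fin k) :
    haveI : Fact (p i).Prime := ⟨hp i⟩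
    qrBit (p i) ((∏ i, p i : ℕ) : ℚ) = ∑ j ∈ Finset.univ.erase i, addLegendreSym (p j) (p i) := by
  haveI : Fact (p i).Prime := ⟨hp i⟩
  have hprod : (∏ j, (p j : ℚ)) = (p i : ℚ) * ∏ j ∈ Finset.univ.erase i, (p j : ℚ) :=
    (Finset.mul_prod_erase _ _ (Finset.mem_univ i)).symm
  have hne : ∀ j ∈ Finset.univ.erase i, (p j : ℚ) ≠ 0 := fun j _ => Nat.cast_ne_zero.mpr (hp j).ne_zero
  rw [show ((∏ i, p i : ℕ) : ℚ) = (p i : ℚ) * ∏ j ∈ Finset.univ.erase i, (p j : ℚ) by push_cast; rw [hprod],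
    qrBit_natCast_mul]
  -- `qrBit` of the product over `j ≠ i`
  have key : ∀ (s : Finset (Fin k)), (∀ j ∈ s, (p j : ℚ) ≠ 0) →
      qrBit (p i) (∏ j ∈ s, (p j : ℚ)) = ∑ j ∈ s, qrBit (p i) (p j : ℚ) := by
    intro s hs
    induction s using Finset.induction_on with
    | empty => simp [qrBit_one]
    | insert a s ha ih =>
      have hs' : ∀ j ∈ s, (p j : ℚ) ≠ 0 := fun j hj => hs j (Finset.mem_insert_of_mem hj)
      rw [Finset.prod_insert ha, Finset.sum_insert ha,
        qrBit_mul (p i) (hs a (Finset.mem_insert_self a s)) (Finset.prod_ne_zero_iff.mpr hs'), ih hs']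
  rw [key _ hne]
  exact Finset.sum_congr rfl fun j hj =>
    qrBit_natCast_eq_addLegendreSym (hp j) (fun h => (Finset.ne_of_mem_erase hj) (hinj h).symm)

/-! ## §3 The local conditions on a Selmer class of `E_n`, `n = p₁⋯p_k` odd -/

variable [hE : (congruentNumberCurve (∏ i, p i)).IsElliptic]
variable (hT : (congruentNumberCurve (∏ i, p i)).toAffine.SplitTwoTorsion
  (-((∏ i, p i : ℕ) : ℚ)) 0 ((∏ i, p i : ℕ) : ℚ))

/-- **Parity off `S = {2, p₁, …, p_k}`**: both components of a Selmer class of `E_n` (`n` odd) have even valuation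
at every odd prime `r ∉ S`. [cite: SilvermanAEC2009, Prop. X.1.4, Prop. X.4.9] -/
theorem even_padicValRat_of_mem (hp : ∀ i, (p i).Prime) (hinj : Function.Injective p)
    {c : galH1Torsion (congruentNumberCurve (∏ i, p i)) 2}
    (hc : c ∈ (congruentNumberCurve (∏ i, p i)).selmerGroup 2) (a b : ℚˣ)
    (ha : kummerEquiv ℚ 2 ((congruentNumberCurve (∏ i, p i)).twoTorsionCharH1 hT c) =
      Additive.ofMul (QuotientGroup.mk a))
    (hb : kummerEquiv ℚ 2 ((congruentNumberCurve (∏ i, p i)).twoTorsionCharH1 hT.swap₁₂ c) =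
      Additive.ofMul (QuotientGroup.mk b))
    {r : ℕ} (hr : r.Prime) (hr2 : r ≠ 2) (hrp : ∀ j, p j ≠ r) :
    haveI : Fact r.Prime := ⟨hr⟩
    Even (padicValRat r (a : ℚ)) ∧ Even (padicValRat r (b : ℚ)) := by
  haveI : Fact r.Prime := ⟨hr⟩
  set W := congruentNumberCurve (∏ i, p i) with hW
  set v : HeightOneSpectrum (𝓞 ℚ) := primesEquiv.symm ⟨r, hr⟩ with hv
  have hrv : (primesEquiv v : ℕ) = r := by rw [hv, Equiv.apply_symm_apply]
  have h0 := padicValRat_two_pow_mul_prod_other hp hinj hr hr2 hrp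
  have e12 : padicValRat r (-((∏ i, p i : ℕ) : ℚ) - 0) = 0 := by
    rw [show (-((∏ i, p i : ℕ) : ℚ)) - 0 = -((2 : ℚ) ^ 0 * ∏ j, (p j : ℚ)) by push_cast; ring,
      padicValRat.neg, h0 0]
  have e13 : padicValRat r (-((∏ i, p i : ℕ) : ℚ) - ((∏ i, p i : ℕ) : ℚ)) = 0 := by
    rw [show (-((∏ i, p i : ℕ) : ℚ)) - ((∏ i, p i : ℕ) : ℚ) = -((2 : ℚ) ^ 1 * ∏ j, (p j : ℚ)) by
      push_cast; ring, padicValRat.neg, h0 1]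
  have e21 : padicValRat r ((0 : ℚ) - -((∏ i, p i : ℕ) : ℚ)) = 0 := by
    rw [show (0 : ℚ) - -((∏ i, p i : ℕ) : ℚ) = (2 : ℚ) ^ 0 * ∏ j, (p j : ℚ) by push_cast; ring, h0 0]
  have e23 : padicValRat r ((0 : ℚ) - ((∏ i, p i : ℕ) : ℚ)) = 0 := by
    rw [show (0 : ℚ) - ((∏ i, p i : ℕ) : ℚ) = -((2 : ℚ) ^ 0 * ∏ j, (p j : ℚ)) by push_cast; ring,
      padicValRat.neg, h0 0]
  constructor
  · have := W.even_padicValRat_of_mem_selmerGroup hT hc v (by rw [hrv]; exact e12) (by rw [hrv]; exact e13) a ha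
    rwa [hrv] at this
  · have := W.even_padicValRat_of_mem_selmerGroup hT.swap₁₂ hc v (by rw [hrv]; exact e21)
      (by rw [hrv]; exact e23) b hb
    rwa [hrv] at this

/-- **The place `2` is GOOD for the second component when `n` is odd**: `v₂(b)` is even for every Selmer class
of `E_n` (the roots `e₂ = 0`, `e₁ = −n`, `e₃ = n` satisfy `v₂(e₂ − e₁) = v₂(e₂ − e₃) = 0`; Silverman X.1.4 at the
place `2`). [cite: SilvermanAEC2009, Prop. X.1.4, Prop. X.4.9] -/
theorem even_padicValRat_two_of_mem (hp : ∀ i, (p i).Prime) (hp2 : ∀ i, p i ≠ 2) (hinj : Function.Injective p)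
    {c : galH1Torsion (congruentNumberCurve (∏ i, p i)) 2}
    (hc : c ∈ (congruentNumberCurve (∏ i, p i)).selmerGroup 2) (b : ℚˣ)
    (hb : kummerEquiv ℚ 2 ((congruentNumberCurve (∏ i, p i)).twoTorsionCharH1 hT.swap₁₂ c) =
      Additive.ofMul (QuotientGroup.mk b)) :
    haveI : Fact (Nat.Prime 2) := ⟨Nat.prime_two⟩
    Even (padicValRat 2 (b : ℚ)) := by
  haveI : Fact (Nat.Prime 2) := ⟨Nat.prime_two⟩
  set W := congruentNumberCurve (∏ i, p i) with hW
  set v : HeightOneSpectrum (𝓞 ℚ) := primesEquiv.symm ⟨2, Nat.prime_two⟩ with hv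
  have hrv : (primesEquiv v : ℕ) = 2 := by rw [hv, Equiv.apply_symm_apply]
  have h0 : padicValRat 2 (∏ j, (p j : ℚ)) = 0 := padicValRat_prod_other hp hinj Nat.prime_two (fun j => hp2 j)
  have e21 : padicValRat 2 ((0 : ℚ) - -((∏ i, p i : ℕ) : ℚ)) = 0 := by
    rw [show (0 : ℚ) - -((∏ i, p i : ℕ) : ℚ) = ∏ j, (p j : ℚ) by push_cast; ring, h0]
  have e23 : padicValRat 2 ((0 : ℚ) - ((∏ i, p i : ℕ) : ℚ)) = 0 := by
    rw [show (0 : ℚ) - ((∏ i, p i : ℕ) : ℚ) = -∏ j, (p j : ℚ) by push_cast; ring, padicValRat.neg, h0]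
  have := W.even_padicValRat_of_mem_selmerGroup hT.swap₁₂ hc v (by rw [hrv]; exact e21)
    (by rw [hrv]; exact e23) b hb
  rwa [hrv] at this

/-- **The real place**: the first component of a Selmer class of `E_n` is positive (`e₁ = −n` is the smallest
root). [cite: SilvermanAEC2009, Prop. X.1.4, Prop. X.4.9] -/
theorem pos_of_mem (hp : ∀ i, (p i).Prime)
    {c : galH1Torsion (congruentNumberCurve (∏ i, p i)) 2}
    (hc : c ∈ (congruentNumberCurve (∏ i, p i)).selmerGroup 2) (a : ℚˣ)
    (ha : kummerEquiv ℚ 2 ((congruentNumberCurve (∏ i, p i)).twoTorsionCharH1 hT c) =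
      Additive.ofMul (QuotientGroup.mk a)) : 0 < (a : ℚ) := by
  have hN : (0 : ℚ) < ((∏ i, p i : ℕ) : ℚ) := by exact_mod_cast Nat.pos_of_ne_zero (prod_ne_zero hp)
  exact (congruentNumberCurve (∏ i, p i)).pos_of_mem_selmerGroup_of_lt hT (by linarith) (by linarith) hc a ha

/-- **The `I₀*` relations at `pᵢ`** for a Selmer class of `E_n`, `n = p₁⋯p_k` odd: with `ℓ = pᵢ`, `α = v_ℓ(a)`,
`β = v_ℓ(b) (mod 2)`, `A_ii = Σ_{j≠i} [(pⱼ/pᵢ) = −1]`: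
`qrBit ℓ a = α·A_ii + β·[2]`, `qrBit ℓ b = α·[−1] + β·([−1] + A_ii)` — the two relations of
`qrBit_eq_of_mem_selmerGroup_of_add` with the constants `e₂ − e₁ = n`, `(e₁ − e₂)(e₁ − e₃) = 2n²`,
`(e₂ − e₁)(e₂ − e₃) = −n²`, `e₁ − e₂ = −n` evaluated (Monsky's four cases at `p`, typescript p. 38 L24–L31).
[cite: SilvermanAEC2009, Prop. X.1.4, Prop. X.4.9] [cite: HeathBrown1994SelmerCongruentII, Appendix (Monsky), typescript p. 38 L24–L31] -/
theorem qrBit_rel_of_mem (hp : ∀ i, (p i).Prime) (hp2 : ∀ i, p i ≠ 2) (hinj : Function.Injective p)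
    {c : galH1Torsion (congruentNumberCurve (∏ i, p i)) 2}
    (hc : c ∈ (congruentNumberCurve (∏ i, p i)).selmerGroup 2) (a b : ℚˣ)
    (ha : kummerEquiv ℚ 2 ((congruentNumberCurve (∏ i, p i)).twoTorsionCharH1 hT c) =
      Additive.ofMul (QuotientGroup.mk a))
    (hb : kummerEquiv ℚ 2 ((congruentNumberCurve (∏ i, p i)).twoTorsionCharH1 hT.swap₁₂ c) =
      Additive.ofMul (QuotientGroup.mk b)) (i : Fin k) :
    haveI : Fact (p i).Prime := ⟨hp i⟩
    qrBit (p i) (a : ℚ) =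
        parityBit (p i) (a : ℚ) * (∑ j ∈ Finset.univ.erase i, addLegendreSym (p j) (p i)) +
          parityBit (p i) (b : ℚ) * addLegendreSym 2 (p i) ∧
      qrBit (p i) (b : ℚ) =
        parityBit (p i) (a : ℚ) * addLegendreSym (-1) (p i) +
          parityBit (p i) (b : ℚ) * (addLegendreSym (-1) (p i) + ∑ j ∈ Finset.univ.erase i, addLegendreSym (p j) (p i)) := by
  haveI : Fact (p i).Prime := ⟨hp i⟩
  set W := congruentNumberCurve (∏ i, p i) with hW
  set v : HeightOneSpectrum (𝓞 ℚ) := primesEquiv.symm ⟨p i, hp i⟩ with hv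
  have hℓv : (primesEquiv v : ℕ) = p i := by rw [hv, Equiv.apply_symm_apply]
  have hN0 : ((∏ i, p i : ℕ) : ℚ) ≠ 0 := by exact_mod_cast prod_ne_zero hp
  have h1 := padicValRat_two_pow_mul_prod_self hp hp2 hinj i
  have h12 : padicValRat (p i) (-((∏ i, p i : ℕ) : ℚ) - 0) = 1 := by
    rw [show -((∏ i, p i : ℕ) : ℚ) - 0 = -((2 : ℚ) ^ 0 * ∏ j, (p j : ℚ)) by push_cast; ring,
      padicValRat.neg, h1 0]
  have h13 : padicValRat (p i) (-((∏ i, p i : ℕ) : ℚ) - ((∏ i, p i : ℕ) : ℚ)) = 1 := by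
    rw [show -((∏ i, p i : ℕ) : ℚ) - ((∏ i, p i : ℕ) : ℚ) = -((2 : ℚ) ^ 1 * ∏ j, (p j : ℚ)) by
      push_cast; ring, padicValRat.neg, h1 1]
  have h23 : padicValRat (p i) ((0 : ℚ) - ((∏ i, p i : ℕ) : ℚ)) = 1 := by
    rw [show (0 : ℚ) - ((∏ i, p i : ℕ) : ℚ) = -((2 : ℚ) ^ 0 * ∏ j, (p j : ℚ)) by push_cast; ring,
      padicValRat.neg, h1 0]
  have key := W.qrBit_eq_of_mem_selmerGroup_of_add hT hc v (by rw [hℓv]; exact h12) (by rw [hℓv]; exact h13)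
    (by rw [hℓv]; exact h23) a b ha hb
  simp only [hℓv] at key
  -- the constants
  have hn := qrBit_n_odd hp hinj i
  have k21 : qrBit (p i) ((0 : ℚ) - -((∏ i, p i : ℕ) : ℚ)) = ∑ j ∈ Finset.univ.erase i, addLegendreSym (p j) (p i) := by
    rw [show (0 : ℚ) - -((∏ i, p i : ℕ) : ℚ) = ((∏ i, p i : ℕ) : ℚ) by ring, hn]
  have k1213 : qrBit (p i) ((-((∏ i, p i : ℕ) : ℚ) - 0) * (-((∏ i, p i : ℕ) : ℚ) - ((∏ i, p i : ℕ) : ℚ))) =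
      addLegendreSym 2 (p i) := by
    rw [show (-((∏ i, p i : ℕ) : ℚ) - 0) * (-((∏ i, p i : ℕ) : ℚ) - ((∏ i, p i : ℕ) : ℚ)) =
        (2 : ℚ) * ((∏ i, p i : ℕ) : ℚ) ^ 2 by ring, qrBit_mul (p i) two_ne_zero (pow_ne_zero 2 hN0),
      qrBit_sq, add_zero, qrBit_two_eq_addLegendreSym (hp2 i)]
  have k2123 : qrBit (p i) (((0 : ℚ) - -((∏ i, p i : ℕ) : ℚ)) * ((0 : ℚ) - ((∏ i, p i : ℕ) : ℚ))) =
      addLegendreSym (-1) (p i) := by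
    rw [show ((0 : ℚ) - -((∏ i, p i : ℕ) : ℚ)) * ((0 : ℚ) - ((∏ i, p i : ℕ) : ℚ)) =
        (-1 : ℚ) * ((∏ i, p i : ℕ) : ℚ) ^ 2 by ring, qrBit_mul (p i) (by norm_num) (pow_ne_zero 2 hN0),
      qrBit_sq, add_zero, qrBit_neg_one_eq_addLegendreSym]
  have k12 : qrBit (p i) (-((∏ i, p i : ℕ) : ℚ) - 0) =
      addLegendreSym (-1) (p i) + ∑ j ∈ Finset.univ.erase i, addLegendreSym (p j) (p i) := by
    rw [show -((∏ i, p i : ℕ) : ℚ) - 0 = (-1 : ℚ) * ((∏ i, p i : ℕ) : ℚ) by ring,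
      qrBit_mul (p i) (by norm_num) hN0, qrBit_neg_one_eq_addLegendreSym, hn]
  rw [k21, k1213, k2123, k12] at key
  exact key

end CongruentNumberOddMonskySelmer

end Literature.NumberTheory.EllipticCurves

end
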